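import Summits.NavierStokesRegularity.NavierStokesRegularity.Theorems.TypeIliouvilleNoTypeII.Negative.NSIBlockStrictGain
import HarnessLib

/-!
# The reach of the super-similar NSI cascades: every exponent in `(1/2, β₀]` is realised

Negative-lane support file for `stmt-NavierStokesRegularity-0056`
(`Summit.NavierStokesRegularity.NavierStokesRegularity.Theses.TypeILiouville.TypeIliouvilleNoTypeII`),
model-class REACH of the counterexample family `glueG` (kill-kit M2′). The tree so far realised ONE
exponent (the block of `exists_superGain_nsiBlock` run at its full gain, `NSITypeIIBlowup_holds`)
inside the window `(1/2, 3/5)` of `IsSuperBlock.rateExp_mem_Ioo`. Here: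

* `log_div_eq_logb_of_cov` — the amplitude exponent `β = log_{σ⁻²} a` of the cascade with gain `a`
  and space ratio `τ` written without the clock: `β = log a / (log a + log τ⁻¹)` (`σ² = τ/a`), with
  `one_half_lt_log_div_iff` (`1/2 < β ⇔ τ⁻¹ < a`) and `log_div_lt_three_fifths_iff`
  (`β < 3/5 ⇔ a²τ³ < 1`);
* `isSuperBlock_of_gain_le` — a block with gain inequality for `g` is a super-block for EVERY
  amplitude `a ∈ (τ⁻¹, g]` (clock `σ = √(τ/a)`; the energy cap is automatic by
  `nsiBlock_gain_sq_mul_cube_lt_one`);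
* `exists_isSuperBlock_rateExp_eq` — **there is `β₀ ∈ (1/2, 3/5)` such that EVERY `β ∈ (1/2, β₀]`
  is the exponent of some super-similar NSI cascade** (`β₀ = log g/(log g + log τ⁻¹)` of the certified block;
  given `β`, run that block at the amplitude `a = exp(β log τ⁻¹/(1−β)) ∈ (τ⁻¹, g]`).

So `reach(M2′) ⊇ (1/2, β₀]` is an INTERVAL issuing from `1/2`, and (with
`IsSuperBlock.rateExp_mem_Ioo`) `(1/2, β₀] ⊆ reach(M2′) ⊆ (1/2, 3/5)`; by `norm_glueG_le_rate` /
`exists_rate_glueG` each such `β` is the exact blow-up rate `|𝔲(t)|_∞ ≍ (T₀ − t)^{−β}` of a weak NSI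
solution (`isWeakNSISolution_glueG`). Which `β ∈ (β₀, 3/5)` are realised (super-gains `gτ → τ^{-1/2}`)
stays open (kill-kit O3). WHAT THIS IS NOT: not a statement about Navier–Stokes solutions.

## References

* W. S. Ożański, arXiv:1709.00602 (2017), §2 (2.2), §5. [`Ozanski2017NSISingular`]
-/

noncomputable section

open MeasureTheory Set Function Filter Topology TopologicalSpace Metric Module
open scoped ENNReal

set_option linter.dupNamespace false

namespace Summit.NavierStokesRegularity.NavierStokesRegularity.Theorems.TypeIliouvilleNoTypeIINegative

open Literature.Analysis.FluidPDE Literature.Barriers.NavierStokesRegularity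
open Literature.Barriers.NavierStokesRegularity.Scheffer

/-- Under the covariance `aσ² = τ` (`σ, a > 0`) the clock-free exponent `log a / (log a + log τ⁻¹)`
is the tree's `log_{σ⁻²} a`. [folklore] -/
theorem log_div_eq_logb_of_cov {τ σ a : ℝ} (hσ : 0 < σ) (ha : 0 < a) (hcov : a * σ ^ 2 = τ) :
    Real.log a / (Real.log a + Real.log τ⁻¹) = Real.logb ((σ⁻¹) ^ 2) a := by
  have hτ : 0 < τ := hcov ▸ mul_pos ha (pow_pos hσ 2)
  have hb : (σ⁻¹) ^ 2 = a * τ⁻¹ := by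
    rw [← hcov, inv_pow, mul_inv, ← mul_assoc, mul_inv_cancel₀ ha.ne', one_mul]
  rw [Real.logb, hb, Real.log_mul ha.ne' (inv_pos.2 hτ).ne']

/-- `1/2 < log a/(log a + log τ⁻¹) ↔ τ⁻¹ < a` for `0 < τ < 1`, `1 ≤ a`. [folklore] -/
theorem one_half_lt_log_div_iff {τ a : ℝ} (hτ₀ : 0 < τ) (hτ₁ : τ < 1) (ha1 : 1 ≤ a) :
    1 / 2 < Real.log a / (Real.log a + Real.log τ⁻¹) ↔ τ⁻¹ < a := by
  have ha : 0 < a := one_pos.trans_le ha1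
  have hL : 0 < Real.log τ⁻¹ := Real.log_pos ((one_lt_inv₀ hτ₀).2 hτ₁)
  have hla : 0 ≤ Real.log a := Real.log_nonneg ha1
  rw [← Real.log_lt_log_iff (inv_pos.2 hτ₀) ha, lt_div_iff₀ (by linarith)]
  constructor <;> intro h <;> linarith

/-- `log a/(log a + log τ⁻¹) < 3/5 ↔ a²τ³ < 1` for `0 < τ < 1`, `τ⁻¹ < a`. [folklore] -/
theorem log_div_lt_three_fifths_iff {τ a : ℝ} (hτ₀ : 0 < τ) (hτ₁ : τ < 1) (ha : τ⁻¹ < a) :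
    Real.log a / (Real.log a + Real.log τ⁻¹) < 3 / 5 ↔ a ^ 2 * τ ^ 3 < 1 := by
  have hτinv : 0 < τ⁻¹ := inv_pos.2 hτ₀
  have ha0 : 0 < a := hτinv.trans ha
  have hL : 0 < Real.log τ⁻¹ := Real.log_pos ((one_lt_inv₀ hτ₀).2 hτ₁)
  have hla : Real.log τ⁻¹ < Real.log a := Real.log_lt_log hτinv ha
  have hden : 0 < Real.log a + Real.log τ⁻¹ := by linarith
  have key : a ^ 2 * τ ^ 3 < 1 ↔ 2 * Real.log a < 3 * Real.log τ⁻¹ := by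
    rw [← Real.log_lt_log_iff (by positivity) one_pos, Real.log_one, Real.log_mul (by positivity)
      (by positivity), Real.log_pow, Real.log_pow, Real.log_inv]
    push_cast
    constructor <;> intro h <;> linarith
  rw [key, div_lt_iff₀ hden]
  constructor <;> intro h <;> linarith

/-- **A block with gain `g` is a super-block at every amplitude `a ∈ (τ⁻¹, g]`** with the clock
`σ = √(τ/a)`: covariance `aσ² = τ`, super-gain `τ⁻¹ < a`, the gain inequality (from `a ≤ g`) and
the energy cap — automatic and strict by `nsiBlock_gain_sq_mul_cube_lt_one`. [folklore] -/
theorem isSuperBlock_of_gain_le {T ν₀ τ : ℝ} {z : EuclideanSpace ℝ (Fin 3)}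
    {G : Set (EuclideanSpace ℝ (Fin 3))}
    {u : ℝ → EuclideanSpace ℝ (Fin 3) → EuclideanSpace ℝ (Fin 3)} (h : IsNSIBlock T ν₀ τ z G u)
    {g a : ℝ} (hgain : ∀ y, g * ‖u 0 y‖ ≤ ‖u T (τ • y + z)‖) (hτa : τ⁻¹ < a) (hag : a ≤ g) :
    IsSuperBlock T ν₀ τ (Real.sqrt (τ / a)) a z G u := by
  have ha0 : 0 < a := (inv_pos.2 h.τ_pos).trans hτa
  have hgain' : ∀ y, a * ‖u 0 y‖ ≤ ‖u T (τ • y + z)‖ := fun y =>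
    (mul_le_mul_of_nonneg_right hag (norm_nonneg _)).trans (hgain y)
  obtain ⟨hσ₀, -, hcov, -, -⟩ := superCascade_params h.τ_pos h.τ_lt_one hτa
  exact ⟨h, hσ₀, hcov, hτa, (nsiBlock_gain_sq_mul_cube_lt_one h ha0.le hgain').le, hgain'⟩

/-- **The reach of the super-similar class is an interval issuing from `1/2`**: there is
`β₀ ∈ (1/2, 3/5)` such that every `β ∈ (1/2, β₀]` is the amplitude exponent `log_{σ⁻²} a` of some
super-similar NSI cascade (`IsSuperBlock`; by `norm_glueG_le_rate` / `exists_rate_glueG` the EXACT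
blow-up rate of the glued weak NSI solution). `β₀ = log g / (log g + log τ⁻¹)` for the certified block of
`exists_superGain_nsiBlock`; `β` is realised by running that block at the amplitude
`a = exp(β log τ⁻¹ / (1 − β))`. [cite: Ozanski2017NSISingular, §2 (2.2), §5] -/
theorem exists_isSuperBlock_rateExp_eq :
    ∃ β₀ : ℝ, 1 / 2 < β₀ ∧ β₀ < 3 / 5 ∧ ∀ β ∈ Ioc (1 / 2 : ℝ) β₀,
      ∃ (T ν₀ τ σ a : ℝ) (z : EuclideanSpace ℝ (Fin 3)) (G : Set (EuclideanSpace ℝ (Fin 3)))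
        (u : ℝ → EuclideanSpace ℝ (Fin 3) → EuclideanSpace ℝ (Fin 3)),
        IsSuperBlock T ν₀ τ σ a z G u ∧ Real.logb ((σ⁻¹) ^ 2) a = β := by
  obtain ⟨T, ν₀, τ, z, G, u, g, hblock, hg, hgain⟩ := exists_superGain_nsiBlock
  have hτ₀ := hblock.τ_pos
  have hτ₁ := hblock.τ_lt_one
  have hτinv : 0 < τ⁻¹ := inv_pos.2 hτ₀
  have hg0 : 0 < g := hτinv.trans hg
  set L : ℝ := Real.log τ⁻¹ with hL
  have hL0 : 0 < L := Real.log_pos ((one_lt_inv₀ hτ₀).2 hτ₁)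
  have hlg : L < Real.log g := Real.log_lt_log hτinv hg
  have hg1 : 1 ≤ g := ((one_lt_inv₀ hτ₀).2 hτ₁).le.trans hg.le
  refine ⟨Real.log g / (Real.log g + Real.log τ⁻¹), (one_half_lt_log_div_iff hτ₀ hτ₁ hg1).2 hg,
    (log_div_lt_three_fifths_iff hτ₀ hτ₁ hg).2
      (nsiBlock_gain_sq_mul_cube_lt_one hblock hg0.le hgain), fun β hβ => ?_⟩
  have hβ1 : β < 1 := by
    have : Real.log g / (Real.log g + Real.log τ⁻¹) < 1 := by
      rw [div_lt_one (by linarith)]; linarith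
    exact hβ.2.trans_lt this
  have h1β : 0 < 1 - β := sub_pos.2 hβ1
  -- the amplitude realising `β`
  set a : ℝ := Real.exp (β * L / (1 - β)) with ha
  have ha0 : 0 < a := Real.exp_pos _
  have hloga : Real.log a = β * L / (1 - β) := Real.log_exp _
  -- `τ⁻¹ < a ⇔ L < log a ⇔ 1/2 < β`
  have hτa : τ⁻¹ < a := by
    rw [← Real.log_lt_log_iff hτinv ha0, hloga, lt_div_iff₀ h1β]
    nlinarith [hβ.1]
  -- `a ≤ g ⇔ β L/(1-β) ≤ log g ⇔ β ≤ β₀`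
  have hag : a ≤ g := by
    rw [← Real.log_le_log_iff ha0 hg0, hloga, div_le_iff₀ h1β]
    have h2 := hβ.2
    rw [le_div_iff₀ (by linarith)] at h2
    linarith
  refine ⟨T, ν₀, τ, Real.sqrt (τ / a), a, z, G, u, isSuperBlock_of_gain_le hblock hgain hτa hag, ?_⟩
  obtain ⟨hσ₀, -, hcov, -, -⟩ := superCascade_params hτ₀ hτ₁ hτa
  have h1βne : 1 - β ≠ 0 := h1β.ne'
  have hden' : Real.log a + L = L / (1 - β) := by
    rw [hloga]; field_simp; ring
  rw [← log_div_eq_logb_of_cov hσ₀ ha0 hcov, ← hL, hden', hloga,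
    div_div_div_cancel_right₀ h1βne, mul_div_cancel_right₀ β hL0.ne']

end Summit.NavierStokesRegularity.NavierStokesRegularity.Theorems.TypeIliouvilleNoTypeIINegative

end
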